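import Mathlib

/-!
# Solo-blind kernel #277 — the block (Schur) structure behind `L` and the read-out

ENGINE-L-SPEC §0 (STRUCTURE THEOREM) and §13: the frozen operator splits into STREAK and ROLL blocks
`M = [[A_s, B], [C, A_r]]` (`B` = the `s ← r` couplings `−εb`, `∓hα/(m±1)`; `C` = the `r ← s`
coupling `−εc`), and the engine certifies `1 − L` with `L := A_s⁻¹ B A_r⁻¹ C` (acting on the streak
space).  This kernel is the exact algebra that identifies that `L` with invertibility of `M` and with
the solution / read-out formula used by kernels #269/#273 (`readout = ℓ((1 − L)⁻¹ src)`):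
* `schur_factor`: `A_s − B A_r⁻¹ C = A_s (1 − L)`;
* `isUnit_fromBlocks_iff_isUnit_one_sub_L`: for `A_s, A_r` invertible, `M` is invertible iff `1 − L` is;
* `streak_eq`, `streak_solution`, `roll_solution`: any solution of `A_s X_s + B X_r = Y_s`,
  `C X_s + A_r X_r = Y_r` satisfies `(1 − L) X_s = src`, `src := A_s⁻¹ (Y_s − B A_r⁻¹ Y_r)`, hence
  `X_s = (1 − L)⁻¹ src` and `X_r = A_r⁻¹ (Y_r − C X_s)` (matrix right-hand sides, so vectors and the
  `p = Unit` column case are included);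
* `solution_exists`: conversely these formulas solve the system.
Over any commutative ring (the chain truncations are matrices over `ℂ`; the `x, g, κ`-dependence is in
the entries).
-/

namespace Summit.AnomalousDissipation.SoloBlind.SchurReadout

open Matrix

variable {𝕜 : Type*} [CommRing 𝕜]
variable {m n p : Type*} [Fintype m] [Fintype n] [DecidableEq m] [DecidableEq n]

/-- The engine's `L = A_s⁻¹ B A_r⁻¹ C` (streak-space operator). -/
noncomputable def L (As : Matrix m m 𝕜) (B : Matrix m n 𝕜) (C : Matrix n m 𝕜) (Ar : Matrix n n 𝕜) :
    Matrix m m 𝕜 := As⁻¹ * B * Ar⁻¹ * C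

/-- The source `src = A_s⁻¹ (Y_s − B A_r⁻¹ Y_r)`. -/
noncomputable def src (As : Matrix m m 𝕜) (B : Matrix m n 𝕜) (Ar : Matrix n n 𝕜) (Ys : Matrix m p 𝕜)
    (Yr : Matrix n p 𝕜) : Matrix m p 𝕜 := As⁻¹ * (Ys - B * (Ar⁻¹ * Yr))

/-- **Schur factorisation**: `A_s − B A_r⁻¹ C = A_s (1 − L)` when `A_s` is invertible. -/
theorem schur_factor {As : Matrix m m 𝕜} (B : Matrix m n 𝕜) (C : Matrix n m 𝕜) (Ar : Matrix n n 𝕜)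
    (hs : IsUnit As.det) : As - B * Ar⁻¹ * C = As * (1 - L As B C Ar) := by
  rw [L, mul_sub, mul_one, ← Matrix.mul_assoc, ← Matrix.mul_assoc, ← Matrix.mul_assoc,
    Matrix.mul_nonsing_inv As hs, Matrix.one_mul]

/-- **`M` invertible ⇔ `1 − L` invertible** (for `A_s`, `A_r` invertible). -/
theorem isUnit_fromBlocks_iff_isUnit_one_sub_L {As : Matrix m m 𝕜} {B : Matrix m n 𝕜}
    {C : Matrix n m 𝕜} {Ar : Matrix n n 𝕜} (hs : IsUnit As.det) (hr : IsUnit Ar.det) :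
    IsUnit (fromBlocks As B C Ar) ↔ IsUnit (1 - L As B C Ar) := by
  have hr' : IsUnit Ar := (Matrix.isUnit_iff_isUnit_det _).2 hr
  have hs' : IsUnit As := (Matrix.isUnit_iff_isUnit_det _).2 hs
  letI : Invertible Ar := hr'.invertible
  rw [Matrix.isUnit_fromBlocks_iff_of_invertible₂₂, Matrix.invOf_eq_nonsing_inv,
    schur_factor B C Ar hs]
  obtain ⟨u, hu⟩ := hs'
  rw [← hu, Units.isUnit_units_mul]

section Solve

variable {As : Matrix m m 𝕜} {B : Matrix m n 𝕜} {C : Matrix n m 𝕜} {Ar : Matrix n n 𝕜}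
  {Xs Ys : Matrix m p 𝕜} {Xr Yr : Matrix n p 𝕜}

omit [DecidableEq m] in
/-- The roll unknown in terms of the streak unknown: `X_r = A_r⁻¹ (Y_r − C X_s)`. -/
theorem roll_solution (hr : IsUnit Ar.det) (h2 : C * Xs + Ar * Xr = Yr) :
    Xr = Ar⁻¹ * (Yr - C * Xs) := by
  have h : Ar * Xr = Yr - C * Xs := by rw [← h2]; abel
  calc Xr = Ar⁻¹ * (Ar * Xr) := by rw [← Matrix.mul_assoc, Matrix.nonsing_inv_mul Ar hr, Matrix.one_mul]
    _ = Ar⁻¹ * (Yr - C * Xs) := by rw [h]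

/-- **The streak equation**: `(1 − L) X_s = src`. -/
theorem streak_eq (hs : IsUnit As.det) (hr : IsUnit Ar.det) (h1 : As * Xs + B * Xr = Ys)
    (h2 : C * Xs + Ar * Xr = Yr) : (1 - L As B C Ar) * Xs = src As B Ar Ys Yr := by
  have hXr := roll_solution hr h2
  have hAs : As * Xs = Ys - B * (Ar⁻¹ * (Yr - C * Xs)) := by rw [← hXr, ← h1]; abel
  calc (1 - L As B C Ar) * Xs = Xs - As⁻¹ * B * Ar⁻¹ * C * Xs := by
        rw [Matrix.sub_mul, Matrix.one_mul, L]
    _ = As⁻¹ * (As * Xs) - As⁻¹ * B * Ar⁻¹ * C * Xs := by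
        rw [← Matrix.mul_assoc As⁻¹ As Xs, Matrix.nonsing_inv_mul As hs, Matrix.one_mul]
    _ = As⁻¹ * (Ys - B * (Ar⁻¹ * (Yr - C * Xs))) - As⁻¹ * B * Ar⁻¹ * C * Xs := by rw [hAs]
    _ = src As B Ar Ys Yr := by
        simp only [src, Matrix.mul_sub, Matrix.mul_assoc]
        abel

/-- **Streak solution**: if moreover `1 − L` is invertible, `X_s = (1 − L)⁻¹ src`. -/
theorem streak_solution (hs : IsUnit As.det) (hr : IsUnit Ar.det)
    (hL : IsUnit (1 - L As B C Ar).det) (h1 : As * Xs + B * Xr = Ys)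
    (h2 : C * Xs + Ar * Xr = Yr) : Xs = (1 - L As B C Ar)⁻¹ * src As B Ar Ys Yr := by
  rw [← streak_eq hs hr h1 h2, ← Matrix.mul_assoc, Matrix.nonsing_inv_mul _ hL, Matrix.one_mul]

/-- **Converse**: the formulas solve the system (so with `1 − L` invertible the solution exists and,
by `streak_solution` / `roll_solution`, is unique). -/
theorem solution_exists (hs : IsUnit As.det) (hr : IsUnit Ar.det)
    (hL : IsUnit (1 - L As B C Ar).det) (Ys : Matrix m p 𝕜) (Yr : Matrix n p 𝕜) :
    As * ((1 - L As B C Ar)⁻¹ * src As B Ar Ys Yr)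
        + B * (Ar⁻¹ * (Yr - C * ((1 - L As B C Ar)⁻¹ * src As B Ar Ys Yr))) = Ys ∧
      C * ((1 - L As B C Ar)⁻¹ * src As B Ar Ys Yr)
        + Ar * (Ar⁻¹ * (Yr - C * ((1 - L As B C Ar)⁻¹ * src As B Ar Ys Yr))) = Yr := by
  set X : Matrix m p 𝕜 := (1 - L As B C Ar)⁻¹ * src As B Ar Ys Yr with hXdef
  have hLX : (1 - L As B C Ar) * X = src As B Ar Ys Yr := by
    rw [hXdef, ← Matrix.mul_assoc, Matrix.mul_nonsing_inv _ hL, Matrix.one_mul]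
  constructor
  · calc As * X + B * (Ar⁻¹ * (Yr - C * X))
          = (As - B * Ar⁻¹ * C) * X + B * (Ar⁻¹ * Yr) := by
            simp only [Matrix.sub_mul, Matrix.mul_sub, Matrix.mul_assoc]; abel
      _ = As * ((1 - L As B C Ar) * X) + B * (Ar⁻¹ * Yr) := by
            rw [schur_factor B C Ar hs, Matrix.mul_assoc]
      _ = As * (As⁻¹ * (Ys - B * (Ar⁻¹ * Yr))) + B * (Ar⁻¹ * Yr) := by rw [hLX, src]
      _ = Ys := by
            rw [← Matrix.mul_assoc As As⁻¹, Matrix.mul_nonsing_inv As hs, Matrix.one_mul]; abel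
  · rw [← Matrix.mul_assoc Ar Ar⁻¹, Matrix.mul_nonsing_inv Ar hr, Matrix.one_mul]; abel

end Solve

end Summit.AnomalousDissipation.SoloBlind.SchurReadout
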